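import Literature.MathematicalPhysics.QuantumFieldTheory.Balaban1983to89.Node00.CarriersZ

/-!
# NODE 00 (YM-PLAN Track A) — THE CRITICALITY PREDICATE OF RECORD: print's «U is a critical configuration of the functional (5) on 𝔅_k(V)»
# ([Balaban1985Variational] (5)–(6) p. 278, Props 7–8 pp. 299–304, Sect. F p. 300) AT NODE 00's OBJECTS, the silent step «minimal ⇒ critical»
# (p. 299) PROVED, and the residual [B11] layer with its criticality slot PINNED to it

NODE 00 module (seat `pub-ymgap-dag-n07-e`, generation 2; cell `pub-ymgap`, HUMAN RULING D-0062; `FAN-OUT.md` §N07 row s3 continued).  NEW importing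
module; `Node00/CarriersZ` (node00-def g30, p429835) and everything below it CONSUMED BY NAME, nothing modified.

T. Bałaban, *The variational problem and background fields in renormalization group method for lattice gauge theories*, Commun. Math. Phys. **102**
(1985) 277–309 [Balaban1985Variational].  Print, p. 278: the variational problem (5)–(6) «find the minimum of U ↦ A(U) over 𝔘_k(ε₀) ∩ 𝔅_k(V)»,
𝔅_k(V) = {U : Ū^k = V} (3); p. 299 [23]: *«Hence A′ = 0 is a minimum … and this implies that U_k is a minimal configuration of the functional A(U)»*;
Prop. 8 p. 304 [28]: *«if U is a critical configuration of (5) in the space (6) with V satisfying (7), and if ε₀ ≦ a₅, then U belongs to the space (8)»*;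
Sect. F p. 300 [24]: *«In this section we will prove all the regularity properties of minimal configurations U_k.  We will use only the fact that they
are critical configurations of the functional (5) and that they belong to the spaces (6) with ε₀ sufficiently small.»*  The step from «minimal» (what
Theorem 1 and (8) speak about) to «critical» (what Props 7 (i), 8 and Sect. F consume) is SILENT in print — a minimiser of a smooth function over an
OPEN subset of the constraint manifold is a critical point of the function on the manifold (the class (2) is defined by STRICT inequalities).

WHAT THIS FILE DOES.  In `Node00/CarriersZ` the criticality predicate consumed by the Props 7–8 ∕ Sect. F family `famXOfRecord F N ζ` is the FREE field
`ζ.IsCrit` of the residual layer `ResidZ` — so every N07 closer of record displays the dictionary residual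
`hcrit : IsBackground (avOfRecord F N K) {U | InUkClassB11 F N K k e U} k V U → ζ.IsCrit ⟨K, k, _⟩ V U` («minimal ⇒ critical»; seats n07-a p433511 ∕ p450629,
n07-d p455032, n07-e p456450 ∕ p458798).  Here:
* §1 `deriv_wilsonAction4_eq_zero_of_isBackground` — the generic FERMAT STEP (any torus, group, averaging family, class): along every curve through a
  minimiser of the Wilson action over `reg ∩ 𝔅_k(V)` which stays (for parameters near the base point) in `reg` and in `𝔅_k(V)`, the derivative of the
  action at the base point vanishes whenever it exists (Mathlib `IsLocalMin.hasDerivAt_eq_zero`).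
* §2 CURVE-OPENNESS OF [B11] (2) AT `Ω_j = T`: both clauses of (2) (plaquette `|U(∂p) − 1| < ε₀L^{−2j}`, current `|(D*_U∂U)(b)| < ε₀L^{−2j}(L^jη)^{−1}`,
  `B10Eq68TorusRegularity.InSpace`) are finitely many STRICT inequalities between CONTINUOUS functions of the bond matrices (`continuous_val_holT`,
  `continuous_plaqFT_ofRecord`, `continuous_covDivT_ofRecord`), hence a configuration-valued map continuous at a point whose value there lies in
  `𝔘_k(e)` takes values in `𝔘_k(e)` near that point (`eventually_inUkClassB11`).
* §2b `differentiableAt_val_holT`, `differentiableAt_wilsonAction4_along` — along a curve of configurations differentiable (as bond matrices) at a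
  point, the transports and the Wilson action (5) are differentiable there ((5) = a polynomial in the bond matrices and their adjoints composed with the
  continuous linear functional `Re Tr ∕ N`): the derivative §3 speaks about EXISTS.
* §3 ★ `IsCritOfRecord F N K k V U` — «U is a critical configuration of (5) on 𝔅_k(V)» in the standard curve form of «dA|_{𝔅_k(V)}(U) = 0»: along EVERY
  curve `γ : ℝ → GaugeField (F.P K) 0 (SU N)` through `U` at `t = 0`, differentiable at `0` (as a curve of bond matrices), lying in `𝔅_k(V)` for `t` near `0`,
  every derivative at `0` of `t ↦ A(γ t)` is `0`.  The class radius does NOT enter (print's notion; (2) is open).  ★ `isCritOfRecord_of_isBackground`: a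
  minimiser of (5) over `𝔘_k(e) ∩ 𝔅_k(V)` (the tree's `IsBackground` over the (2)-class, ANY `e`) is critical — §1 + §2.  `isCritOfRecord_iff_hasDerivAt_zero`
  (by §2b the predicate IS «(A ∘ γ)′(0) = 0 along every admissible curve»); `isCritOfRecord_levelZero` (genuine at `k = 0`); `isCritOfRecord_gaugeAct`,
  `isCritOfRecord_iff_of_orbitRel` (criticality is a property of the RESIDUAL ORBIT — print's «critical orbit», (4)–(6): the constraint surface and the
  action are invariant under `u = 1` on `T⁽ᵏ⁾`, `B12GaugeOrbits021`; standing range `k ≤ m + K`).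
* §4 ★ `ResidZ.pinCrit ζ` — the residual layer `ζ` with its criticality slot PINNED to `IsCritOfRecord` (regularity data `R`, the Props 2–6 ∕ Prop. 9
  carriers, the twelve constants UNCHANGED; `famVOfRecord` unchanged, `rfl`); ★ `hcrit_pinCrit`: the displayed `hcrit` of the N07 closers HOLDS at
  `ζ.pinCrit` — a theorem, no longer a residual.

HONEST FRAMING: one definition of record + kernel bookkeeping + one elementary real-analysis step; NO estimate of [Balaban1985Variational] proved or
asserted; the regularity data `R` of (9)–(10) (finding F8: genuine cubes) and the carriers `famLG`, `famAn` stay residual; N07 NOT discharged; counts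
unmoved; one finite T⁴ programme at fixed ε — NOT continuum ∕ ℝ⁴ ∕ infinite volume ∕ OS ∕ mass gap ∕ Clay.  No `sorry`, no `axiom`, no `instance`,
no `notation`.
-/

noncomputable section

namespace Literature.MathematicalPhysics.QuantumFieldTheory.Balaban1983to89.Node00

open Filter Topology
open T4Continuum (T4Family)
open B7Prop1Explicit (plaqWord)
open B7Eq78Linearization (conjR)
open B10Eq27TorusAxialLog (holT holT_nil holT_cons_true holT_cons_false holT_plaqWord_eq_plaqHol toUField unitsField suIncl val_suIncl
  holT_toUField val_holT_unitsField val_unitsField)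
open B12GaugeOrbits021 (IsResidual OrbitRel iter_gaugeAct_of_isResidual wilsonAction4_eq_of_orbitRel gaugeAct_inv)
open UnitaryModel (nReTr)
open B10Eq68TorusRegularity (InSpace InSpaceA RegPlaqAt RegDivAt plaqFT covDerivT covDivT Touches BTouches)
open scoped Matrix.Norms.L2Operator

/-! ## §1 The Fermat step: a minimiser over `reg ∩ 𝔅_k(V)` has vanishing action-derivative along admissible curves -/

section Fermat

variable {P : Params} {G : Type*} [GaugeGroup G]

/-- **THE FERMAT STEP** (generic: any torus `P`, gauge group `G`, averaging family `av`, class `reg`).  If `U` minimises the Wilson action (5) over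
`reg ∩ 𝔅_k(V)` (the tree's `IsBackground av reg k V U`) and `γ` is a curve of configurations with `γ t₀ = U` which, for parameters near `t₀`, stays in
`reg` and in the constraint surface `𝔅_k(V) = {Ū^k = V}`, then `t ↦ A(γ t)` has a local minimum at `t₀`, so its derivative there — whenever it exists —
is `0` (Fermat).  This is the silent step of p. 299 from «U_k is a minimal configuration of the functional A(U)» to «critical configuration of (5)»
(p. 300), in the form consumed by §3. [cite: Balaban1985Variational, (5)–(6) p.278, p.299 (before (141)), p.300 (Sect. F, first paragraph)] -/
theorem deriv_wilsonAction4_eq_zero_of_isBackground {av : ∀ j, Averaging P j G} {reg : Set (GaugeField P 0 G)} {k : ℕ}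
    {V : GaugeField P k G} {U : GaugeField P 0 G} (h : IsBackground av reg k V U)
    {γ : ℝ → GaugeField P 0 G} {t₀ : ℝ} (h0 : γ t₀ = U) (hreg : ∀ᶠ t in 𝓝 t₀, γ t ∈ reg)
    (hcons : ∀ᶠ t in 𝓝 t₀, Averaging.iter av k (γ t) = V) {a : ℝ}
    (ha : HasDerivAt (fun t => wilsonAction4 (γ t)) a t₀) : a = 0 := by
  refine IsLocalMin.hasDerivAt_eq_zero ?_ ha
  show ∀ᶠ t in 𝓝 t₀, wilsonAction4 (γ t₀) ≤ wilsonAction4 (γ t)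
  filter_upwards [hreg, hcons] with t ht hc
  rw [h0]
  exact h.2.2 (γ t) ht hc

end Fermat

/-! ## §2 Curve-openness of [B11] (2) at `Ω_j = T`: the letters of (2) are continuous functions of the bond matrices -/

section Openness

variable {P : Params} {j : ℕ} {N : ℕ}

/-- **Parallel transports are continuous functions of the configuration** (Pi topology on `PBond P j → SU(N)`; no instance is declared on
`GaugeField`): for every base point `s` and lattice word `w`, `U ↦ U(w from s) ∈ M_N(ℂ)` is continuous — products of bond matrices and their adjoints.
[cite: Balaban1985Averaging, (9) p.18; Balaban1985Variational, (2) p.278 (the letters of the class)] -/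
theorem continuous_val_holT : ∀ (w : List (B7Prop1Explicit.Letter P.d)) (s : Site P j),
    Continuous (fun U : PBond P j → SU N => ((holT U s w : SU N) : Matrix (Fin N) (Fin N) ℂ))
  | [], s => by
    simp only [holT_nil]
    exact continuous_const
  | (μ, true) :: w, s => by
    simp only [holT_cons_true, Submonoid.coe_mul]
    exact ((continuous_subtype_val.comp (continuous_apply _))).mul (continuous_val_holT w (s.shift μ))
  | (μ, false) :: w, s => by
    simp only [holT_cons_false, Submonoid.coe_mul]
    refine Continuous.mul ?_ (continuous_val_holT w (s.unshift μ))
    show Continuous (fun U : PBond P j → SU N => star ((U ⟨s.unshift μ, μ⟩ : SU N) : Matrix (Fin N) (Fin N) ℂ))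
    exact (continuous_subtype_val.comp (continuous_apply _)).star

/-- The bond matrices of the `M_N(ℂ)`-reading are the `SU(N)` bond matrices (`rfl`). [cite: Balaban1985Averaging, (19) p.21 (the U(N) model)] -/
theorem val_unitsField_toUField (U : GaugeField P j (SU N)) (b : PBond P j) :
    ((unitsField (toUField U) b : (Matrix (Fin N) (Fin N) ℂ)ˣ) : Matrix (Fin N) (Fin N) ℂ) = ((U b : SU N) : Matrix (Fin N) (Fin N) ℂ) := rfl

/-- The plaquette field of (2) read in `M_N(ℂ)` through `unitsField ∘ toUField` IS the `SU(N)` transport along the plaquette word (bookkeeping of the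
two readings of the cell's `U(N)` model). [cite: Balaban1985Variational, (2) p.278; Balaban1985Averaging, (9) p.19] -/
theorem plaqFT_unitsField_toUField (U : GaugeField P j (SU N)) (μ ν : Fin P.d) (s : Site P j) :
    plaqFT (unitsField (toUField U)) μ ν s = ((holT U s (plaqWord μ ν) : SU N) : Matrix (Fin N) (Fin N) ℂ) := by
  unfold plaqFT
  rw [val_holT_unitsField, holT_toUField, val_suIncl]

/-- The bond units of the `M_N(ℂ)`-reading invert to the adjoint bond matrices. [cite: Balaban1985Averaging, (19) p.21 (the U(N) model)] -/
theorem val_inv_unitsField_toUField (U : GaugeField P j (SU N)) (b : PBond P j) :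
    (((unitsField (toUField U) b)⁻¹ : (Matrix (Fin N) (Fin N) ℂ)ˣ) : Matrix (Fin N) (Fin N) ℂ) = star ((U b : SU N) : Matrix (Fin N) (Fin N) ℂ) := by
  show (((Unitary.toUnits (suIncl (U b)))⁻¹ : (Matrix (Fin N) (Fin N) ℂ)ˣ) : Matrix (Fin N) (Fin N) ℂ) = _
  rw [← map_inv]
  rfl

/-- **The plaquette letters of (2) are continuous functions of the configuration.** [cite: Balaban1985Variational, (2) p.278] -/
theorem continuous_plaqFT_ofRecord (μ ν : Fin P.d) (s : Site P j) :
    Continuous (fun U : PBond P j → SU N => plaqFT (unitsField (toUField U)) μ ν s) := by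
  simp only [plaqFT_unitsField_toUField]
  exact continuous_val_holT _ _

/-- **The current letters `(D*_U ∂U)(b)` of (2) are continuous functions of the configuration** (finite sums of conjugated differences of plaquette
fields). [cite: Balaban1985Variational, (2) p.278; Balaban1985RegularSpaces, (1.1)–(1.2) p.76] -/
theorem continuous_covDivT_ofRecord (η : ℝ) (μ : Fin P.d) (s : Site P j) :
    Continuous (fun U : PBond P j → SU N => covDivT η (unitsField (toUField U)) μ s) := by
  have h1 : ∀ b : PBond P j, Continuous (fun U : PBond P j → SU N =>
      (((unitsField (toUField U) b)⁻¹ : (Matrix (Fin N) (Fin N) ℂ)ˣ) : Matrix (Fin N) (Fin N) ℂ)) := fun b => by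
    simp only [val_inv_unitsField_toUField]
    exact (continuous_subtype_val.comp (continuous_apply _)).star
  have h2 : ∀ b : PBond P j, Continuous (fun U : PBond P j → SU N =>
      (((unitsField (toUField U) b)⁻¹⁻¹ : (Matrix (Fin N) (Fin N) ℂ)ˣ) : Matrix (Fin N) (Fin N) ℂ)) := fun b => by
    simp only [inv_inv, val_unitsField_toUField]
    exact continuous_subtype_val.comp (continuous_apply _)
  have hder : ∀ (ν κ κ' : Fin P.d) (x : Site P j),
      Continuous (fun U : PBond P j → SU N => covDerivT η (unitsField (toUField U)) ν (plaqFT (unitsField (toUField U)) κ κ') x) := by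
    intro ν κ κ' x
    unfold covDerivT conjR
    exact ((((h1 _).mul (continuous_plaqFT_ofRecord κ κ' _)).mul (h2 _)).sub (continuous_plaqFT_ofRecord κ κ' x)).const_smul _
  unfold covDivT
  exact (continuous_finsetSum _ fun ν _ => hder ν ν μ s).sub (continuous_finsetSum _ fun ν _ => hder ν μ ν s)

/-- **CURVE-OPENNESS OF [B11] (2) AT `Ω_j = T`.**  If a configuration-valued map `γ` is continuous at `x₀` (Pi topology of the bond matrices) and
`γ x₀ ∈ 𝔘_k(e)` (n01-b's `InUkClassB11`: both clauses of (2), all `j ≤ k`), then `γ x ∈ 𝔘_k(e)` for all `x` near `x₀` — (2) consists of finitely many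
STRICT inequalities between continuous functions of the configuration. [cite: Balaban1985Variational, (2) p.278 («𝔘_k(ε₀) = {U : |U(∂p) − 1| < ε₀L^{−2j} …}», strict)] -/
theorem eventually_inUkClassB11 {F : T4Family} {X : Type*} [TopologicalSpace X] {K k : ℕ} {e : ℝ} {γ : X → (PBond (F.P K) 0 → SU N)} {x₀ : X}
    (hγ : ContinuousAt γ x₀) (h : InUkClassB11 F N K k e (γ x₀)) : ∀ᶠ x in 𝓝 x₀, InUkClassB11 F N K k e (γ x) := by
  have hfin : ∀ i : Fin (k + 1), ∀ᶠ x in 𝓝 x₀,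
      RegPlaqAt (i : ℕ) (Set.univ : Set (Site (F.P K) 0)) e (unitsField (toUField (γ x))) ∧
        RegDivAt (i : ℕ) (Set.univ : Set (Site (F.P K) 0)) e ((F.P K).eta k) (unitsField (toUField (γ x))) := by
    intro i
    have hi : (i : ℕ) ≤ k := Nat.lt_succ_iff.mp i.2
    obtain ⟨hP, hD⟩ := (h (i : ℕ) hi : _)
    refine Filter.Eventually.and ?_ ?_
    · have hq : ∀ q : Plaq (F.P K) 0, ∀ᶠ x in 𝓝 x₀,
          ‖plaqFT (unitsField (toUField (γ x))) q.μ q.ν q.src - 1‖ < e * ((((F.P K).L : ℝ) ^ (i : ℕ))⁻¹) ^ 2 := by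
        intro q
        have hc : ContinuousAt (fun x => ‖plaqFT (unitsField (toUField (γ x))) q.μ q.ν q.src - 1‖) x₀ :=
          (((continuous_plaqFT_ofRecord q.μ q.ν q.src).continuousAt.comp hγ).sub continuousAt_const).norm
        exact hc.eventually_lt continuousAt_const (hP q (Or.inl (Set.mem_univ _)))
      exact (eventually_all.2 hq).mono fun x hx q _ => hx q
    · have hb : ∀ b : PBond (F.P K) 0, ∀ᶠ x in 𝓝 x₀,
          ‖covDivT ((F.P K).eta k) (unitsField (toUField (γ x))) b.dir b.src‖ <
            e * ((((F.P K).L : ℝ) ^ (i : ℕ))⁻¹) ^ 2 * (((F.P K).L : ℝ) ^ (i : ℕ) * (F.P K).eta k)⁻¹ := by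
        intro b
        have hc : ContinuousAt (fun x => ‖covDivT ((F.P K).eta k) (unitsField (toUField (γ x))) b.dir b.src‖) x₀ :=
          ((continuous_covDivT_ofRecord ((F.P K).eta k) b.dir b.src).continuousAt.comp hγ).norm
        exact hc.eventually_lt continuousAt_const (hD b (Or.inl (Set.mem_univ _)))
      exact (eventually_all.2 hb).mono fun x hx b _ => hx b
  exact (eventually_all.2 hfin).mono fun x hx j hj => hx ⟨j, Nat.lt_succ_of_le hj⟩

end Openness

/-! ## §2b The action along differentiable curves is differentiable (so `IsCritOfRecord` below is the usual «(A ∘ γ)′(0) = 0») -/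

section AlongCurves

variable {P : Params} {j : ℕ} {N : ℕ}

/-- **Parallel transports along a differentiable curve of configurations are differentiable** (bond matrices in `M_N(ℂ)` with the operator norm;
products and adjoints of differentiable matrix-valued functions). [cite: Balaban1985Averaging, (9) p.18; Balaban1985Variational, (5) p.278 (the letters of the action)] -/
theorem differentiableAt_val_holT {γ : ℝ → GaugeField P j (SU N)} {t₀ : ℝ}
    (hd : DifferentiableAt ℝ (fun (t : ℝ) (b : PBond P j) => ((γ t b : SU N) : Matrix (Fin N) (Fin N) ℂ)) t₀) :
    ∀ (w : List (B7Prop1Explicit.Letter P.d)) (s : Site P j),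
      DifferentiableAt ℝ (fun t => ((holT (γ t) s w : SU N) : Matrix (Fin N) (Fin N) ℂ)) t₀
  | [], s => by
    simp only [holT_nil]
    exact differentiableAt_const _
  | (μ, true) :: w, s => by
    simp only [holT_cons_true, Submonoid.coe_mul]
    exact ((differentiableAt_pi.1 hd) _).mul (differentiableAt_val_holT hd w (s.shift μ))
  | (μ, false) :: w, s => by
    simp only [holT_cons_false, Submonoid.coe_mul]
    refine DifferentiableAt.mul ?_ (differentiableAt_val_holT hd w (s.unshift μ))
    show DifferentiableAt ℝ (fun t => star ((γ t ⟨s.unshift μ, μ⟩ : SU N) : Matrix (Fin N) (Fin N) ℂ)) t₀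
    exact ((differentiableAt_pi.1 hd) _).star

variable [NeZero N]

/-- `Re tr` of the cell's `SU(N)` model read on the matrix: the continuous ℝ-linear functional `W ↦ Re Tr W / N` of `M_N(ℂ)`.
[cite: Balaban1987RG1, (0.2) p.252 (the normalized trace of the action)] -/
theorem reTr_eq_traceLinearMap (g : SU N) :
    reTr g = ((Matrix.traceLinearMap (Fin N) ℝ ℂ) (g : Matrix (Fin N) (Fin N) ℂ)).re / (Fintype.card (Fin N) : ℝ) := rfl

/-- **THE WILSON ACTION ALONG A DIFFERENTIABLE CURVE OF CONFIGURATIONS IS DIFFERENTIABLE** — (5) is a polynomial in the bond matrices and their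
adjoints composed with the continuous linear functional `Re Tr ∕ N`; hence along the curves of §3 the derivative of `t ↦ A(γ t)` at `0` EXISTS, and the
criticality predicate below says it is `0` (`isCritOfRecord_iff_hasDerivAt_zero`). [cite: Balaban1985Variational, (5) p.278; Balaban1987RG1, (0.2) p.252] -/
theorem differentiableAt_wilsonAction4_along {γ : ℝ → GaugeField P j (SU N)} {t₀ : ℝ}
    (hd : DifferentiableAt ℝ (fun (t : ℝ) (b : PBond P j) => ((γ t b : SU N) : Matrix (Fin N) (Fin N) ℂ)) t₀) :
    DifferentiableAt ℝ (fun t => wilsonAction4 (γ t)) t₀ := by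
  have hp : ∀ p : Plaq P j, DifferentiableAt ℝ (fun t => reTr (GaugeField.plaqHol (γ t) p)) t₀ := by
    intro p
    have h1 : DifferentiableAt ℝ (fun t => ((GaugeField.plaqHol (γ t) p : SU N) : Matrix (Fin N) (Fin N) ℂ)) t₀ := by
      simp only [← holT_plaqWord_eq_plaqHol]
      exact differentiableAt_val_holT hd _ _
    have h2 : DifferentiableAt ℝ
        (fun t => ((Matrix.traceLinearMap (Fin N) ℝ ℂ) ((GaugeField.plaqHol (γ t) p : SU N) : Matrix (Fin N) (Fin N) ℂ)).re) t₀ :=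
      Complex.reCLM.differentiableAt.comp t₀
        ((LinearMap.toContinuousLinearMap (Matrix.traceLinearMap (Fin N) ℝ ℂ)).differentiableAt.comp t₀ h1)
    simp only [reTr_eq_traceLinearMap]
    exact h2.div_const _
  unfold wilsonAction4 wilsonAction
  exact DifferentiableAt.fun_sum fun p _ => (differentiableAt_const _).mul ((differentiableAt_const _).sub (hp p))

end AlongCurves

/-! ## §3 The criticality predicate of record and «minimal ⇒ critical» -/

section Critical

variable (F : T4Family) (N : ℕ) [NeZero N]

/-- ★ **«U IS A CRITICAL CONFIGURATION OF THE FUNCTIONAL (5) ON 𝔅_k(V)»** at NODE 00's objects (`SU(N)`, the `K`-th torus of the family, the averaging of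
record), in the standard curve form of «the differential of `A` restricted to the constraint surface `𝔅_k(V) = {U : Ū^k = V}` vanishes at `U`»: for every
curve `γ : ℝ → GaugeField (F.P K) 0 (SU N)` with `γ 0 = U`, differentiable at `0` as a curve of bond matrices (`M_N(ℂ)` with the operator norm), and lying
in `𝔅_k(V)` for all `t` near `0`, every derivative at `0` of `t ↦ A(γ t)` (the Wilson action (5)) is `0`.  The class `𝔘_k(ε₀)` of (2) does not enter:
print's criticality is a property on the constraint manifold, and (2) is open (§2).  (The notion Props 7 (i), 8 and Sect. F take as HYPOTHESIS and the
located existence steps (112)–(142) conclude.) [cite: Balaban1985Variational, (5)–(6) p.278, Prop. 7 p.299, Prop. 8 p.304, Sect. F p.300] -/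
def IsCritOfRecord (K k : ℕ) (V : GaugeField (F.P K) k (SU N)) (U : GaugeField (F.P K) 0 (SU N)) : Prop :=
  ∀ γ : ℝ → GaugeField (F.P K) 0 (SU N), γ 0 = U →
    DifferentiableAt ℝ (fun (t : ℝ) (b : PBond (F.P K) 0) => ((γ t b : SU N) : Matrix (Fin N) (Fin N) ℂ)) 0 →
      (∀ᶠ t in 𝓝 0, Averaging.iter (avOfRecord F N K) k (γ t) = V) →
        ∀ a : ℝ, HasDerivAt (fun t => wilsonAction4 (γ t)) a 0 → a = 0

variable {F N}

omit [NeZero N] in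
/-- A curve of configurations differentiable at a point as a curve of bond matrices is continuous there in the Pi topology of `PBond → SU(N)`.
[cite: Balaban1985Variational, (2) p.278 (bookkeeping for the openness step)] -/
theorem continuousAt_of_differentiableAt_val {K : ℕ} {γ : ℝ → GaugeField (F.P K) 0 (SU N)} {t₀ : ℝ}
    (hd : DifferentiableAt ℝ (fun (t : ℝ) (b : PBond (F.P K) 0) => ((γ t b : SU N) : Matrix (Fin N) (Fin N) ℂ)) t₀) :
    ContinuousAt (fun t (b : PBond (F.P K) 0) => γ t b) t₀ := by
  rw [continuousAt_pi]
  intro b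
  have hb : ContinuousAt (fun t => ((γ t b : SU N) : Matrix (Fin N) (Fin N) ℂ)) t₀ :=
    (continuousAt_pi.1 hd.continuousAt) b
  exact Topology.IsInducing.subtypeVal.continuousAt_iff.2 hb

/-- ★ **«MINIMAL ⇒ CRITICAL» — the silent step of p. 299, PROVED at NODE 00's objects**: a configuration on a minimal orbit of (5) in `𝔘_k(e) ∩ 𝔅_k(V)`
(the tree's `IsBackground (avOfRecord F N K) {U | InUkClassB11 F N K k e U} k V U`, for ANY radius `e`) is a critical configuration of (5) on `𝔅_k(V)`.
Proof: a curve through `U` differentiable at `0` is continuous there, so stays in the OPEN class `𝔘_k(e)` (§2) and, by hypothesis, in `𝔅_k(V)`; hence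
`t ↦ A(γ t)` has a local minimum at `0` and its derivative there vanishes (§1).  This is exactly the displayed residual `hcrit` of the N07 closers of
record. [cite: Balaban1985Variational, p.299 («U_k is a minimal configuration of the functional A(U)»), p.300 («We will use only the fact that they are critical configurations of the functional (5)»)] -/
theorem isCritOfRecord_of_isBackground {K k : ℕ} {e : ℝ} {V : GaugeField (F.P K) k (SU N)} {U : GaugeField (F.P K) 0 (SU N)}
    (h : IsBackground (avOfRecord F N K) {U | InUkClassB11 F N K k e U} k V U) : IsCritOfRecord F N K k V U := by
  intro γ h0 hd hc a ha
  have hγ : ContinuousAt (fun t (b : PBond (F.P K) 0) => γ t b) 0 := continuousAt_of_differentiableAt_val hd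
  have hU : InUkClassB11 F N K k e (γ 0) := by
    rw [h0]
    exact h.2.1
  exact deriv_wilsonAction4_eq_zero_of_isBackground h h0 (eventually_inUkClassB11 hγ hU) hc ha

/-- The level-`k = 0` instance is GENUINE, not vacuous: every `V ∈ 𝔘_0(e)` is its own background over `𝔘_0(e) ∩ 𝔅_0(V) = {V}` (n07-a's
`B11Thm1LevelZero`), hence a critical configuration of (5) on `𝔅_0(V)`. [cite: Balaban1985Variational, Thm 1 p.279 (`k = 0`: «U₀ = V₀»)] -/
theorem isCritOfRecord_levelZero {K : ℕ} {e : ℝ} {V : GaugeField (F.P K) 0 (SU N)} (hV : InUkClassB11 F N K 0 e V) :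
    IsCritOfRecord F N K 0 V V :=
  isCritOfRecord_of_isBackground (e := e) ⟨rfl, hV, fun _ _ hU => le_of_eq (congrArg wilsonAction4 hU.symm)⟩

/-- **THE PREDICATE OF RECORD IS THE USUAL «(A ∘ γ)′(0) = 0»**: since the derivative along every admissible curve EXISTS (§2b), `IsCritOfRecord` says
exactly that it vanishes. [cite: Balaban1985Variational, (5)–(6) p.278, Prop. 8 p.304 («critical configuration of (5)»)] -/
theorem isCritOfRecord_iff_hasDerivAt_zero {K k : ℕ} {V : GaugeField (F.P K) k (SU N)} {U : GaugeField (F.P K) 0 (SU N)} :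
    IsCritOfRecord F N K k V U ↔
      ∀ γ : ℝ → GaugeField (F.P K) 0 (SU N), γ 0 = U →
        DifferentiableAt ℝ (fun (t : ℝ) (b : PBond (F.P K) 0) => ((γ t b : SU N) : Matrix (Fin N) (Fin N) ℂ)) 0 →
          (∀ᶠ t in 𝓝 0, Averaging.iter (avOfRecord F N K) k (γ t) = V) → HasDerivAt (fun t => wilsonAction4 (γ t)) 0 0 := by
  refine ⟨fun h γ h0 hd hc => ?_, fun h γ h0 hd hc a ha => ha.unique (h γ h0 hd hc)⟩
  have hD := (differentiableAt_wilsonAction4_along hd).hasDerivAt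
  rwa [h γ h0 hd hc _ hD] at hD

/-- **CRITICALITY IS A PROPERTY OF THE RESIDUAL ORBIT** (print's «critical orbit», (4)–(6) p. 278): a residual gauge transformation of level `k`
(`u = 1` on `T⁽ᵏ⁾`) maps critical configurations of (5) on `𝔅_k(V)` to critical ones — the constraint surface and the action are invariant
(`B12GaugeOrbits021.iter_gaugeAct_of_isResidual`, `wilsonAction4_eq_of_orbitRel`), and `γ ↦ (γ ·)^{u⁻¹}` preserves differentiability; standing range
`k ≤ m + K`. [cite: Balaban1985Variational, (4)–(6) p.278, Prop. 7 p.299 («critical orbit»)] -/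
theorem isCritOfRecord_gaugeAct {K k : ℕ} (hk : k ≤ (F.P K).m + (F.P K).K) {V : GaugeField (F.P K) k (SU N)} {U : GaugeField (F.P K) 0 (SU N)}
    (h : IsCritOfRecord F N K k V U) {u : GaugeTransf (F.P K) 0 (SU N)} (hu : IsResidual k u) :
    IsCritOfRecord F N K k V (GaugeField.gaugeAct u U) := by
  intro γ h0 hd hc a ha
  have hu' : IsResidual k (u⁻¹ : Site (F.P K) 0 → SU N) := fun y => by
    show (u _)⁻¹ = 1
    rw [hu y, inv_one]
  refine h (fun t => GaugeField.gaugeAct (u⁻¹ : Site (F.P K) 0 → SU N) (γ t)) ?_ ?_ ?_ a ?_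
  · show GaugeField.gaugeAct (u⁻¹ : Site (F.P K) 0 → SU N) (γ 0) = U
    rw [h0, gaugeAct_inv]
  · rw [differentiableAt_pi] at hd ⊢
    intro b
    show DifferentiableAt ℝ (fun t => (((u⁻¹ : Site (F.P K) 0 → SU N) b.src * γ t b * ((u⁻¹ : Site (F.P K) 0 → SU N) b.tgt)⁻¹ : SU N) :
      Matrix (Fin N) (Fin N) ℂ)) 0
    simp only [Submonoid.coe_mul]
    exact ((differentiableAt_const _).mul (hd b)).mul (differentiableAt_const _)
  · exact hc.mono fun t ht => by rw [iter_gaugeAct_of_isResidual _ hk hu', ht]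
  · have hA : (fun t => wilsonAction4 (GaugeField.gaugeAct (u⁻¹ : Site (F.P K) 0 → SU N) (γ t))) = fun t => wilsonAction4 (γ t) :=
      funext fun t => wilsonAction4_eq_of_orbitRel ⟨(u⁻¹ : Site (F.P K) 0 → SU N), hu', rfl⟩
    rw [hA]
    exact ha

/-- Criticality of (5) on `𝔅_k(V)` is constant on residual orbits (`k ≤ m + K`). [cite: Balaban1985Variational, (4)–(6) p.278, Prop. 7 p.299] -/
theorem isCritOfRecord_iff_of_orbitRel {K k : ℕ} (hk : k ≤ (F.P K).m + (F.P K).K) (V : GaugeField (F.P K) k (SU N))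
    {U U' : GaugeField (F.P K) 0 (SU N)} (hUU' : OrbitRel k U U') : IsCritOfRecord F N K k V U ↔ IsCritOfRecord F N K k V U' := by
  refine ⟨fun h => ?_, fun h => ?_⟩
  · obtain ⟨u, hu, rfl⟩ := hUU'
    exact isCritOfRecord_gaugeAct hk h hu
  · obtain ⟨u, hu, rfl⟩ := hUU'.symm
    exact isCritOfRecord_gaugeAct hk h hu

end Critical

/-! ## §4 The residual [B11] layer with its criticality slot pinned -/

section Pin

variable {F : T4Family} {N : ℕ} [NeZero N]

/-- ★ **THE CRIT-PINNED RESIDUAL LAYER**: `ζ` with its criticality slot `IsCrit` PINNED to the predicate of record `IsCritOfRecord` — the regularity data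
`R` of (9)–(10), the Props 2–6 carriers `famLG`, the Prop. 9 carriers `famAn` and the twelve constants UNCHANGED. [cite: Balaban1985Variational, Props 7–8 pp.299–304, Sect. F p.300 («critical configurations of the functional (5)»)] -/
def ResidZ.pinCrit (ζ : ResidZ F N) : ResidZ F N :=
  { ζ with IsCrit := fun i => IsCritOfRecord F N i.K i.k }

/-- The pinned slot IS the predicate of record (`rfl`). [cite: Balaban1985Variational, Props 7–8 pp.299–304 (bookkeeping)] -/
@[simp] theorem ResidZ.pinCrit_IsCrit (ζ : ResidZ F N) (i : ZIdx) : ζ.pinCrit.IsCrit i = IsCritOfRecord F N i.K i.k := rfl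

/-- Pinning leaves the regularity data `R` unchanged (`rfl`). [cite: Balaban1985Variational, (9)–(10) p.279 (bookkeeping)] -/
@[simp] theorem ResidZ.pinCrit_R (ζ : ResidZ F N) : ζ.pinCrit.R = ζ.R := rfl

/-- Pinning leaves the Props 2–6 carriers unchanged (`rfl`). [cite: Balaban1985Variational, Props 2–6 pp.281–296 (bookkeeping)] -/
@[simp] theorem ResidZ.pinCrit_famLG (ζ : ResidZ F N) : ζ.pinCrit.famLG = ζ.famLG := rfl

/-- Pinning leaves the Prop. 9 carriers unchanged (`rfl`). [cite: Balaban1985Variational, Prop. 9 p.309 (bookkeeping)] -/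
@[simp] theorem ResidZ.pinCrit_famAn (ζ : ResidZ F N) : ζ.pinCrit.famAn = ζ.famAn := rfl

/-- Pinning is idempotent (`rfl`). [cite: Balaban1985Variational, Props 7–8 pp.299–304 (bookkeeping)] -/
theorem ResidZ.pinCrit_pinCrit (ζ : ResidZ F N) : ζ.pinCrit.pinCrit = ζ.pinCrit := rfl

/-- The Theorem-1 family of record does not read the criticality slot: it is the same at `ζ.pinCrit` and at `ζ` (`rfl`).
[cite: Balaban1985Variational, Thm 1 p.279 (bookkeeping)] -/
theorem famVOfRecord_pinCrit (ζ : ResidZ F N) : famVOfRecord F N ζ.pinCrit = famVOfRecord F N ζ := rfl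

/-- The Props 7–8 ∕ Sect. F family at the pinned layer: the same variational problem and orbit relation, with «critical» = the predicate of record
(`rfl` on the criticality field). [cite: Balaban1985Variational, (4)–(6) p.278, Props 7–8 pp.299–304 (bookkeeping)] -/
theorem famXOfRecord_pinCrit_isCritical (ζ : ResidZ F N) (i : ZIdx) :
    (famXOfRecord F N ζ.pinCrit i).IsCritical = IsCritOfRecord F N i.K i.k := rfl

/-- ★ **THE DISPLAYED `hcrit` OF THE N07 CLOSERS HOLDS AT THE CRIT-PINNED LAYER** — «minimal ⇒ critical» for `ζ.pinCrit.IsCrit`, every member, every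
radius: a THEOREM (§3), no longer a residual. [cite: Balaban1985Variational, p.299 («U_k is a minimal configuration of the functional A(U)»), p.300] -/
theorem hcrit_pinCrit (ζ : ResidZ F N) (i : ZIdx) (e : ℝ) (V : GaugeField (F.P i.K) i.k (SU N)) (U : GaugeField (F.P i.K) 0 (SU N))
    (h : IsBackground (avOfRecord F N i.K) {U | InUkClassB11 F N i.K i.k e U} i.k V U) : ζ.pinCrit.IsCrit i V U :=
  isCritOfRecord_of_isBackground h

end Pin

end Literature.MathematicalPhysics.QuantumFieldTheory.Balaban1983to89.Node00

end
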